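import Mathlib.LinearAlgebra.BilinearMap
import Mathlib.LinearAlgebra.FiniteDimensional.Lemmas
import HarnessLib

/-!
# Kloosterman's no-excess criterion for a pencil of two pairings (linear-algebra core of Lemma 2.9)

R. Kloosterman, *On a conjecture on Hodge loci of linear combinations of linear subvarieties*,
Rend. Circ. Mat. Palermo (2) (2025), doi:10.1007/s12215-025-01307-4 = arXiv:2312.12363, §2.3 'Bilinear maps'
(Notation 2.4, Lemma 2.9) and §3 (Lemma 3.12, Theorem 3.13, Corollary 3.14) [cite: Kloosterman2025, Lemma 2.9].

**Printed setting (Notation 2.4 / §2.3).** `V`, `W` are `ℂ`-vector spaces, `φ₁, φ₂ : V × W → ℂ` bilinear,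
`V_i = ker_L(φ_i)`, `W_i = ker_R(φ_i)`, with `V₁ ∩ V₂ = 0` and `W₁ ∩ W₂ = 0`. For two ideals `I₁, I₂ ⊂ S` with
`S/I_j` graded Artinian Gorenstein of the same socle degree `t` and fixed isomorphisms `σ_j : (S/I_j)_t → ℂ`,
`φ_j` is the pairing `S/(I₁∩I₂)_α × S/(I₁∩I₂)_{t−α} → (S/I_j)_t → ℂ`.

**Lemma 2.9 (verbatim).** "If `h_{I₁+I₂}(t−α) = 0` then for all `λ ∈ ℂ*` we have `ker_L(φ₁+λφ₂) = 0`."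
Printed proof: "If `h_{I₁+I₂}(t−α) = 0` then `h_{I₁∩I₂}(t−α) = h_{I₁}(t−α)+h_{I₂}(t−α)` by Lemma (lemHP). The
left kernel of `φ_j` equals `(I_j/I₁∩I₂)_α`. Hence the rank of `φ_j` equals `h_{I_j}(α)`, which equals
`h_{I_j}(t−α)` by Gorenstein duality. In particular, we have that `dim S/(I₁∩I₂)_{t−α} = r₁+r₂` and
`ker_R(φ₁) ⊕ ker_R(φ₂) = (S/I₁∩I₂)_{t−α}`. Suppose now that `v ∈ ker_L(φ₁+λφ₂)` and that `λ ≠ 0`. Then for all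
`w ∈ ker_R(φ₂)` we have `0 = φ₁(v,w)+λφ₂(v,w) = φ₁(v,w)`. This implies that `v` is in the orthogonal
complement of `ker_R(φ₂)` with respect to `φ₁`, since it is also in the orthogonal space of `ker_R(φ₁)` we
obtain that `v` is in the orthogonal space of `ker_R(φ₁)+ker_R(φ₂) = W` with respect to `φ₁`, i.e.,
`v ∈ ker_L(φ₁)`. Similarly `v ∈ ker_L(φ₂)` and therefore `v ∈ V₁ ∩ V₂ = {0}`."

**What this file proves.** Exactly the second half of that argument, over an arbitrary field `K` and arbitrary
`K`-modules: if the left kernels of `φ₁, φ₂` meet in `0` and the right kernels SPAN `W` (the printed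
intermediate conclusion `ker_R(φ₁) ⊕ ker_R(φ₂) = W`, of which only 'span' is used), then
`ker_L(φ₁ + c·φ₂) = 0` for every `c ≠ 0` (`leftKernel_add_smul_eq_bot`); together with the finite-dimensional
bookkeeping step 'right kernels disjoint and of complementary dimensions ⇒ they span'
(`sup_eq_top_of_disjoint_of_finrank_add_eq`), which is how the hypothesis `h_{I₁+I₂}(t−α) = 0` enters in print
(`dim ker_R φ₁ + dim ker_R φ₂ = (h_{I₁∩I₂} − h_{I₁}) + (h_{I₁∩I₂} − h_{I₂}) = h_{I₁∩I₂} = dim W` at degree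
`t − α`, and `ker_R φ₁ ∩ ker_R φ₂ = (I₁ ∩ I₂)/(I₁∩I₂) = 0`). A pairing is encoded as a curried linear map
`B : V →ₗ[K] W →ₗ[K] K`; its left kernel is `LinearMap.ker B` and its right kernel is `LinearMap.ker B.flip`.

**Why it is vendored (use in the tree).** By [cite: Kloosterman2025, Lemma 3.12], for two `k`-dimensional
subvarieties `Y₁, Y₂` of a smooth hypersurface `X ⊂ ℙ^{2k+1}` of degree `d` (socle degree
`t = (k+1)(d−2)`, `α = d`), `T_X NL([Y₁]+λ[Y₂]) / T_X NL([Y₁],[Y₂]) = ker_L(ψ₁ + ν(λ)ψ₂)` with `ν(λ) ≠ 0`; so the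
lemma below is the printed mechanism behind "no excess tangent dimension at ANY `λ ∈ ℚ*`" under
`h_{I₁+I₂}(kd−2k−2) = 0` ([cite: Kloosterman2025, Cor. 3.14] states the self-dual case `d = kd−2k−2`). The
Artinian Gorenstein ideals, Lemma 3.12 and the Hodge loci themselves are NOT formalised here.
-/

namespace Literature.AlgebraicGeometry.Kloosterman2025

open Module

section Core

variable {K : Type*} [Field K] {V W : Type*} [AddCommGroup V] [Module K V] [AddCommGroup W] [Module K W]

/-- The right kernel `ker_R(φ)` of a pairing `φ : V × W → K`, encoded as the kernel of the flipped curried map: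
`w ∈ ker_R(φ) ↔ ∀ v, φ(v,w) = 0`. [cite: Kloosterman2025, Notation 2.4] -/
theorem mem_ker_flip_iff (B : V →ₗ[K] W →ₗ[K] K) (w : W) :
    w ∈ LinearMap.ker B.flip ↔ ∀ v, B v w = 0 := by
  constructor
  · intro hw v
    have h := LinearMap.congr_fun (LinearMap.mem_ker.mp hw) v
    simpa using h
  · intro h
    refine LinearMap.mem_ker.mpr ?_
    ext v
    simpa using h v

/-- The left kernel `ker_L(φ)`: `v ∈ ker_L(φ) ↔ ∀ w, φ(v,w) = 0`. [cite: Kloosterman2025, Notation 2.4] -/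
theorem mem_ker_iff_forall (B : V →ₗ[K] W →ₗ[K] K) (v : V) :
    v ∈ LinearMap.ker B ↔ ∀ w, B v w = 0 := by
  constructor
  · intro hv w
    have h := LinearMap.congr_fun (LinearMap.mem_ker.mp hv) w
    simpa using h
  · intro h
    refine LinearMap.mem_ker.mpr ?_
    ext w
    simpa using h w

/-- **Kloosterman, Lemma 2.9 (linear-algebra core).** Let `φ₁, φ₂ : V × W → K` be two pairings whose left
kernels meet in `0` (`V₁ ∩ V₂ = 0`) and whose right kernels span `W` (`ker_R(φ₁) + ker_R(φ₂) = W`, the printed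
consequence of `h_{I₁+I₂}(t−α) = 0`). Then for every `c ≠ 0` the pencil member `φ₁ + c·φ₂` has trivial left
kernel: `ker_L(φ₁ + cφ₂) = 0`. The proof is the printed one: a left-kernel vector of `φ₁ + cφ₂` is
`φ₁`-orthogonal to `ker_R(φ₂)` and (trivially) to `ker_R(φ₁)`, hence to `W`, so it lies in `ker_L(φ₁)`;
symmetrically (using `c ≠ 0`) it lies in `ker_L(φ₂)`. [cite: Kloosterman2025, Lemma 2.9] -/
theorem leftKernel_add_smul_eq_bot (B₁ B₂ : V →ₗ[K] W →ₗ[K] K)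
    (hL : LinearMap.ker B₁ ⊓ LinearMap.ker B₂ = ⊥)
    (hR : LinearMap.ker B₁.flip ⊔ LinearMap.ker B₂.flip = ⊤)
    {c : K} (hc : c ≠ 0) :
    LinearMap.ker (B₁ + c • B₂) = ⊥ := by
  refine (Submodule.eq_bot_iff _).mpr ?_
  intro v hv
  have hv' : ∀ w, B₁ v w + c * B₂ v w = 0 := by
    intro w
    have h := (mem_ker_iff_forall (B₁ + c • B₂) v).mp hv w
    simpa using h
  -- every `w` decomposes as `w₁ + w₂` with `w₁ ∈ ker_R(φ₁)`, `w₂ ∈ ker_R(φ₂)`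
  have hdec : ∀ w : W, ∃ w₁ ∈ LinearMap.ker B₁.flip, ∃ w₂ ∈ LinearMap.ker B₂.flip, w = w₁ + w₂ := by
    intro w
    have hw : w ∈ LinearMap.ker B₁.flip ⊔ LinearMap.ker B₂.flip := by rw [hR]; exact Submodule.mem_top
    obtain ⟨w₁, hw₁, w₂, hw₂, rfl⟩ := Submodule.mem_sup.mp hw
    exact ⟨w₁, hw₁, w₂, hw₂, rfl⟩
  -- `v ∈ ker_L(φ₁)`
  have h1 : v ∈ LinearMap.ker B₁ := by
    refine (mem_ker_iff_forall B₁ v).mpr ?_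
    intro w
    obtain ⟨w₁, hw₁, w₂, hw₂, rfl⟩ := hdec w
    have a : B₁ v w₁ = 0 := (mem_ker_flip_iff B₁ w₁).mp hw₁ v
    have b2 : B₂ v w₂ = 0 := (mem_ker_flip_iff B₂ w₂).mp hw₂ v
    have b : B₁ v w₂ = 0 := by
      have := hv' w₂
      rw [b2, mul_zero, add_zero] at this
      exact this
    simp [map_add, a, b]
  -- `v ∈ ker_L(φ₂)` (uses `c ≠ 0`)
  have h2 : v ∈ LinearMap.ker B₂ := by
    refine (mem_ker_iff_forall B₂ v).mpr ?_
    intro w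
    obtain ⟨w₁, hw₁, w₂, hw₂, rfl⟩ := hdec w
    have a1 : B₁ v w₁ = 0 := (mem_ker_flip_iff B₁ w₁).mp hw₁ v
    have a : B₂ v w₁ = 0 := by
      have := hv' w₁
      rw [a1, zero_add] at this
      exact (mul_eq_zero.mp this).resolve_left hc
    have b : B₂ v w₂ = 0 := (mem_ker_flip_iff B₂ w₂).mp hw₂ v
    simp [map_add, a, b]
  have : v ∈ LinearMap.ker B₁ ⊓ LinearMap.ker B₂ := Submodule.mem_inf.mpr ⟨h1, h2⟩
  rw [hL] at this
  exact (Submodule.mem_bot K).mp this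

/-- Pointwise form of `leftKernel_add_smul_eq_bot`: under the same hypotheses, a vector `v` with
`φ₁(v,w) + c·φ₂(v,w) = 0` for all `w` (and `c ≠ 0`) is zero. [cite: Kloosterman2025, Lemma 2.9] -/
theorem eq_zero_of_forall_pairing_add_smul_eq_zero (B₁ B₂ : V →ₗ[K] W →ₗ[K] K)
    (hL : LinearMap.ker B₁ ⊓ LinearMap.ker B₂ = ⊥)
    (hR : LinearMap.ker B₁.flip ⊔ LinearMap.ker B₂.flip = ⊤)
    {c : K} (hc : c ≠ 0) {v : V} (hv : ∀ w, B₁ v w + c * B₂ v w = 0) : v = 0 := by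
  have hmem : v ∈ LinearMap.ker (B₁ + c • B₂) := by
    refine (mem_ker_iff_forall (B₁ + c • B₂) v).mpr ?_
    intro w
    simpa using hv w
  rw [leftKernel_add_smul_eq_bot B₁ B₂ hL hR hc] at hmem
  exact (Submodule.mem_bot K).mp hmem

end Core

section FiniteDimensional

variable {K : Type*} [Field K] {W : Type*} [AddCommGroup W] [Module K W] [FiniteDimensional K W]

/-- The bookkeeping step of the printed proof of Lemma 2.9: two subspaces of a finite-dimensional space
that meet in `0` and have complementary dimensions span it ("`dim S/(I₁∩I₂)_{t−α} = r₁+r₂` and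
`ker_R(φ₁) ⊕ ker_R(φ₂) = (S/I₁∩I₂)_{t−α}`"). [folklore; used in [cite: Kloosterman2025, Lemma 2.9]] -/
theorem sup_eq_top_of_disjoint_of_finrank_add_eq (W₁ W₂ : Submodule K W)
    (hdisj : W₁ ⊓ W₂ = ⊥) (hdim : finrank K W₁ + finrank K W₂ = finrank K W) :
    W₁ ⊔ W₂ = ⊤ := by
  have h := Submodule.finrank_sup_add_finrank_inf_eq W₁ W₂
  rw [hdisj, finrank_bot, add_zero, hdim] at h
  exact Submodule.eq_top_of_finrank_eq h

variable {V : Type*} [AddCommGroup V] [Module K V]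

/-- **Kloosterman, Lemma 2.9 (finite-dimensional form).** If the left kernels of `φ₁, φ₂` meet in `0`, the right
kernels meet in `0`, and `dim ker_R(φ₁) + dim ker_R(φ₂) = dim W` (which is what `h_{I₁+I₂}(t−α) = 0` yields in
the printed proof, via `h_{I₁∩I₂} = h_{I₁} + h_{I₂}` and Gorenstein duality), then `ker_L(φ₁ + cφ₂) = 0` for all
`c ≠ 0`. [cite: Kloosterman2025, Lemma 2.9] -/
theorem leftKernel_add_smul_eq_bot_of_finrank (B₁ B₂ : V →ₗ[K] W →ₗ[K] K)
    (hL : LinearMap.ker B₁ ⊓ LinearMap.ker B₂ = ⊥)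
    (hRdisj : LinearMap.ker B₁.flip ⊓ LinearMap.ker B₂.flip = ⊥)
    (hRdim : finrank K (LinearMap.ker B₁.flip) + finrank K (LinearMap.ker B₂.flip) = finrank K W)
    {c : K} (hc : c ≠ 0) :
    LinearMap.ker (B₁ + c • B₂) = ⊥ :=
  leftKernel_add_smul_eq_bot B₁ B₂ hL
    (sup_eq_top_of_disjoint_of_finrank_add_eq _ _ hRdisj hRdim) hc

end FiniteDimensional

end Literature.AlgebraicGeometry.Kloosterman2025
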